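import Mathlib.Data.List.Basic
import Mathlib.Data.Finset.Basic

/-!
# FrustratedLawDichotomy · crux `AperiodicFrustratedLawGap` (stmt-AtomisticToContinuum-27623) — class-A K-file skeleton, layer 3a:
the CLASS-TABLE container (binary search tree keyed by the integer class key) and its transport lemmas (decomp-a2c hand-2 g47, structural
share; mechanics LABELS-SCALE (c) of record, crit r1809: «CLASS TABLES = BINARY SEARCH TREE keyed by q … hit-check 25.9 s, fold 30.7 s ≈ 1.7
ms/lookup at F1 scale»; lens-5 probe g113/check/scale/C4_bst.lean generalised to any leaf type)

A K-file's «Classes» layer stores, per VALUE of the integer class key `q` (F1: 899 values), a leaf of READINGS (hand-1's integer / ℚ class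
numbers: window brackets, host, debit, NASH coefficient …).  The container is a plain binary search tree `BT α` given as ONE constructor term by
the census generator; the kernel work per cell is (i) ONE `decide` that every leaf passes the class test (`BT.all ok t = true`, |Q| checks) and
(ii) ONE hit-check over the label LIST (`∀ m ∈ labL, (t.find (key m)).isSome`), after which `BT.all_find` TRANSPORTS the class fact to every
label with no per-label arithmetic: `t.find (key m) = some v → ok (key m) v = true`.  Also: `findD` (total lookup with a default, the shape a
`List.sum` fold uses), `forall_hits` (the per-label packaging), `keys`/`find_some_mem_keys` (a found key is a stored key).  Pure data-structure
facts; no analysis, no cell data.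
-/

namespace Summit.AtomisticToContinuum.Crystallization.Theorems.FrustratedLawDichotomyCellBST

/-- binary search tree keyed by `ℤ` with leaves of type `α` (no balance invariant is needed: soundness below holds for ANY tree; the generator
emits a balanced one for speed). -/
inductive BT (α : Type) where
  | nil : BT α
  | node : BT α → ℤ → α → BT α → BT α

namespace BT

variable {α : Type}

/-- `O(depth)` lookup of the leaf stored at key `q`. -/
def find (q : ℤ) : BT α → Option α
  | nil => none
  | node l k v r => if q < k then l.find q else if k < q then r.find q else some v

/-- total lookup with a default (the shape used inside `List.map`/`List.sum` folds). -/
def findD (q : ℤ) (t : BT α) (d : α) : α := (t.find q).getD d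

/-- every stored `(key, leaf)` passes the Boolean test `p` (ONE `decide +kernel` per cell, |Q| checks). -/
def all (p : ℤ → α → Bool) : BT α → Bool
  | nil => true
  | node l k v r => l.all p && p k v && r.all p

/-- the stored keys, in order. -/
def keys : BT α → List ℤ
  | nil => []
  | node l k _ r => l.keys ++ k :: r.keys

/-- the number of stored leaves. -/
def size : BT α → ℕ
  | nil => 0
  | node l _ _ r => l.size + 1 + r.size

/-- ★ TRANSPORT: if every leaf passes `p`, whatever `find` returns passes `p` at the QUERIED key (the found node's key equals the query). -/
theorem all_find {p : ℤ → α → Bool} : ∀ {t : BT α}, t.all p = true → ∀ {q : ℤ} {v : α}, t.find q = some v → p q v = true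
  | nil, _, q, v, hf => by simp [find] at hf
  | node l k w r, h, q, v, hf => by
    simp only [all, Bool.and_eq_true] at h
    obtain ⟨⟨hl, hk⟩, hr⟩ := h
    unfold find at hf
    split_ifs at hf with h1 h2
    · exact all_find hl hf
    · exact all_find hr hf
    · have hq : q = k := le_antisymm (not_lt.mp h2) (not_lt.mp h1)
      have hv : w = v := by simpa using hf
      subst hq; subst hv; exact hk

/-- a found key is a stored key. -/
theorem find_some_mem_keys : ∀ {t : BT α} {q : ℤ} {v : α}, t.find q = some v → q ∈ t.keys
  | nil, q, v, hf => by simp [find] at hf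
  | node l k w r, q, v, hf => by
    unfold find at hf
    simp only [keys, List.mem_append, List.mem_cons]
    split_ifs at hf with h1 h2
    · exact Or.inl (find_some_mem_keys hf)
    · exact Or.inr (Or.inr (find_some_mem_keys hf))
    · exact Or.inr (Or.inl (le_antisymm (not_lt.mp h2) (not_lt.mp h1)))

/-- `findD` returns the found leaf. -/
theorem findD_of_find {t : BT α} {q : ℤ} {v : α} (h : t.find q = some v) (d : α) : t.findD q d = v := by
  simp [findD, h]

/-- on a hit, `findD` passes the class test. -/
theorem all_findD {p : ℤ → α → Bool} {t : BT α} (hall : t.all p = true) {q : ℤ} (hhit : (t.find q).isSome = true) (d : α) :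
    p q (t.findD q d) = true := by
  obtain ⟨v, hv⟩ := Option.isSome_iff_exists.mp hhit
  rw [findD_of_find hv]; exact all_find hall hv

/-- ★ PER-LABEL PACKAGING: a decided hit-check over a label list plus the decided leaf test give, for every label, a leaf that `find` returns AND
that passes the class test at the label's key — the two kernel facts a «Classes» file decides, and nothing per label. -/
theorem forall_hits {β : Type} {key : β → ℤ} {L : List β} {t : BT α} {p : ℤ → α → Bool}
    (hhit : ∀ m ∈ L, (t.find (key m)).isSome = true) (hall : t.all p = true) :
    ∀ m ∈ L, ∃ v, t.find (key m) = some v ∧ p (key m) v = true := by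
  intro m hm
  obtain ⟨v, hv⟩ := Option.isSome_iff_exists.mp (hhit m hm)
  exact ⟨v, hv, all_find hall hv⟩

/-- the same, phrased with the total lookup (the form a fold over the label list consumes). -/
theorem forall_hits_findD {β : Type} {key : β → ℤ} {L : List β} {t : BT α} {p : ℤ → α → Bool}
    (hhit : ∀ m ∈ L, (t.find (key m)).isSome = true) (hall : t.all p = true) (d : α) :
    ∀ m ∈ L, p (key m) (t.findD (key m) d) = true :=
  fun m hm => all_findD hall (hhit m hm) d

/-- monotonicity of the leaf test (weaken the decided test to the one a lemma consumes). -/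
theorem all_mono {p p' : ℤ → α → Bool} (hpp : ∀ q v, p q v = true → p' q v = true) :
    ∀ {t : BT α}, t.all p = true → t.all p' = true
  | nil, _ => rfl
  | node l k w r, h => by
    simp only [all, Bool.and_eq_true] at h ⊢
    exact ⟨⟨all_mono hpp h.1.1, hpp _ _ h.1.2⟩, all_mono hpp h.2⟩

end BT

end Summit.AtomisticToContinuum.Crystallization.Theorems.FrustratedLawDichotomyCellBST
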